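import Summits.AnomalousDissipation.AnomalousDissipation.Theses.RootDecompCycle2B

/-!
# Glue of the split of `RootDecompCycle2B.EnergyLanding` (stmt-AnomalousDissipation-26352)

Sorry-free proof of the GLUE item `RootDecompCycle2B.EnergyLandingGlue` (stmt-AnomalousDissipation-26918):
`LowModeLanding → InertialLanding → TaylorBridge → EnergyLanding` — composition of the three implications
(low-mode landing ⇒ inertial landing ⇒ Taylor-box landing ⇒ energy landing).  No facts are asserted.
Source: decomp-ad cell, writer g2 split of 2B:26352 (sketch `energyLandingGlue_holds : fun h1 h2 hB hA => hB (h2 (h1 hA))`,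
lens-5 kernel `TaylorLanding.lean`); landed by the cell's prover seat.
-/

set_option linter.dupNamespace false

namespace Summit.AnomalousDissipation.AnomalousDissipation.Theorems.EnergyLandingGlue

open Summit.AnomalousDissipation.AnomalousDissipation.Theses.RootDecompCycle2B

/-- The GLUE item `RootDecompCycle2B.EnergyLandingGlue` (stmt-AnomalousDissipation-26918) holds: composition. [folklore] -/
theorem energyLandingGlue_holds : EnergyLandingGlue :=
  fun h1 h2 hB hA => hB (h2 (h1 hA))

end Summit.AnomalousDissipation.AnomalousDissipation.Theorems.EnergyLandingGlue
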